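import Mathlib

/-!
# Ring core of ORDER-2 DETERMINACY OF REGULARITY (lens 4, gen 5; OURS; supports the crux idea
`artin-greenberg-laurent-slice` on `Theses.Descent.DescentPerfectToAll`)

For a Noetherian local ring `A` and a non-zero-divisor `s ∈ 𝔪_A`, regularity of `A` is decided by the
pair `(A/(s²), s̄)`: `A` is regular iff `μ(𝔪_{A/(s²)}) = dim (A/(s)) + 1` — because `(s²) ⊆ 𝔪²` does not
change the minimal number of generators of the maximal ideal (Nakayama) and `dim A = dim A/(s) + 1`.
Consequently two such pairs with `A/(s²) ≅ A′/(s′²)` matching `s̄ ↦ s̄′` are regular together. This is the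
local-ring statement behind `isRegular_iff_of_truncEquiv_two` (flat proper `𝕜⟦s⟧`-models agreeing
mod `s²` are regular together). [folklore]
-/

open IsLocalRing

set_option linter.dupNamespace false

namespace Summit.ResolutionOfSingularities.ResolutionOfSingularities.Cruxes.DescentPerfectToAll.ArtinGreenberg

section Nakayama

variable {A : Type*} [CommRing A] [IsLocalRing A] [IsNoetherianRing A]

/-- NAKAYAMA: an ideal `I ⊆ 𝔪²` does not change the minimal number of generators of the maximal
ideal: `μ(𝔪_{A/I}) = μ(𝔪_A)`. [folklore] -/
theorem spanFinrank_maximalIdeal_quotient {I : Ideal A} (hI : I ≤ (maximalIdeal A) ^ 2)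
    [IsLocalRing (A ⧸ I)] :
    (maximalIdeal (A ⧸ I)).spanFinrank = (maximalIdeal A).spanFinrank := by
  classical
  have hmap : (maximalIdeal A).map (Ideal.Quotient.mk I) = maximalIdeal (A ⧸ I) :=
    map_maximalIdeal_of_surjective _ Ideal.Quotient.mk_surjective
  have hfg : (maximalIdeal A).FG := IsNoetherian.noetherian _
  apply le_antisymm
  · rw [← hmap]
    exact Ideal.spanFinrank_map_le_of_fg _ hfg
  · obtain ⟨s, hscard, hsspan⟩ :=
      Submodule.FG.exists_span_finset_card_eq_spanFinrank
        (IsNoetherian.noetherian (maximalIdeal (A ⧸ I)))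
    -- lift the generators
    let g : A ⧸ I → A := fun x => (Ideal.Quotient.mk_surjective x).choose
    have hg : ∀ x, Ideal.Quotient.mk I (g x) = x :=
      fun x => (Ideal.Quotient.mk_surjective x).choose_spec
    let t : Finset A := s.image g
    -- `span t ≤ 𝔪`
    have ht_le : Ideal.span (t : Set A) ≤ maximalIdeal A := by
      rw [Ideal.span_le]
      intro a ha
      obtain ⟨x, hx, rfl⟩ := Finset.mem_image.mp (Finset.mem_coe.mp ha)
      have hxm : x ∈ maximalIdeal (A ⧸ I) := by
        rw [← hsspan]; exact Submodule.subset_span (Finset.mem_coe.mpr hx)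
      intro hu
      exact hxm (by simpa [hg x] using hu.map (Ideal.Quotient.mk I))
    -- `𝔪 ≤ span t ⊔ 𝔪 • 𝔪`
    have hle : maximalIdeal A ≤ Ideal.span (t : Set A) ⊔ maximalIdeal A • maximalIdeal A := by
      intro m hm
      have hmI : Ideal.Quotient.mk I m ∈ (Ideal.span (t : Set A)).map (Ideal.Quotient.mk I) := by
        have hmem : Ideal.Quotient.mk I m ∈ maximalIdeal (A ⧸ I) := by
          rw [← hmap]; exact Ideal.mem_map_of_mem _ hm
        rw [← hsspan] at hmem
        rw [Ideal.map_span]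
        refine Submodule.span_mono ?_ hmem
        intro x hx
        exact ⟨g x, Finset.mem_coe.mpr (Finset.mem_image_of_mem g (Finset.mem_coe.mp hx)), hg x⟩
      have hm' : m ∈ (Ideal.span (t : Set A)) ⊔ I := by
        have hc := Ideal.mem_comap.mpr hmI
        rwa [Ideal.comap_map_of_surjective' _ Ideal.Quotient.mk_surjective, Ideal.mk_ker] at hc
      have hI' : I ≤ maximalIdeal A • maximalIdeal A := by
        simpa [pow_two, Ideal.smul_eq_mul] using hI
      exact (sup_le_sup_left hI' _) hm'
    have hN : maximalIdeal A ≤ Ideal.span (t : Set A) :=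
      Submodule.le_of_le_smul_of_le_jacobson_bot hfg (maximalIdeal_le_jacobson ⊥) hle
    have heq : Ideal.span (t : Set A) = maximalIdeal A := le_antisymm ht_le hN
    calc (maximalIdeal A).spanFinrank = (Ideal.span (t : Set A)).spanFinrank := by rw [heq]
      _ ≤ (t : Set A).ncard := Submodule.spanFinrank_span_le_ncard_of_finite t.finite_toSet
      _ = t.card := Set.ncard_coe_finset t
      _ ≤ s.card := Finset.card_image_le
      _ = _ := hscard

end Nakayama

section Determinacy

variable {A : Type*} [CommRing A] [IsLocalRing A] [IsNoetherianRing A]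

-- sanity: quotient of a local ring by a proper ideal is local (instance search)
example (I : Ideal A) [Nontrivial (A ⧸ I)] : IsLocalRing (A ⧸ I) :=
  IsLocalRing.of_surjective' (Ideal.Quotient.mk I) Ideal.Quotient.mk_surjective

omit [IsNoetherianRing A] in
/-- The instance binders `[IsLocalRing (A ⧸ Ideal.span {s ^ 2})]` below are dischargeable from
`s ∈ 𝔪_A` (use `haveI := isLocalRing_quot_of_le_maximalIdeal …`). -/
theorem isLocalRing_quot_of_le_maximalIdeal {I : Ideal A} (hI : I ≤ maximalIdeal A) :
    IsLocalRing (A ⧸ I) := by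
  have hne : I ≠ ⊤ := fun h => (maximalIdeal.isMaximal A).ne_top (top_le_iff.mp (h ▸ hI))
  haveI : Nontrivial (A ⧸ I) := Ideal.Quotient.nontrivial_iff.mpr hne
  exact IsLocalRing.of_surjective' (Ideal.Quotient.mk I) Ideal.Quotient.mk_surjective

omit [IsNoetherianRing A] in
theorem isLocalRing_quot_span_sq {s : A} (hs : s ∈ maximalIdeal A) :
    IsLocalRing (A ⧸ Ideal.span {s ^ 2}) :=
  isLocalRing_quot_of_le_maximalIdeal
    (Ideal.span_le.mpr (Set.singleton_subset_iff.mpr ((maximalIdeal A).pow_mem_of_mem hs 2 two_pos)))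

omit [IsNoetherianRing A] in
theorem span_sq_le_maximalIdeal_sq {s : A} (hs : s ∈ maximalIdeal A) :
    Ideal.span {s ^ 2} ≤ maximalIdeal A ^ 2 :=
  Ideal.span_le.mpr (Set.singleton_subset_iff.mpr (Ideal.pow_mem_pow hs 2))

/-- THE NUMERICAL TEST: for a non-zero-divisor `s ∈ 𝔪_A`, `A` is regular iff
`μ(𝔪_{A/(s²)}) = dim (A/(s)) + 1`; both sides of the test are read off `(A/(s²), s̄)`. [folklore] -/
theorem isRegularLocalRing_iff_sq {s : A} (hs : s ∈ maximalIdeal A) (hreg : IsSMulRegular A s)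
    [IsLocalRing (A ⧸ Ideal.span {s ^ 2})] :
    IsRegularLocalRing A ↔
      ((maximalIdeal (A ⧸ Ideal.span {s ^ 2})).spanFinrank : WithBot ℕ∞) =
        ringKrullDim (A ⧸ Ideal.span {s}) + 1 := by
  rw [isRegularLocalRing_iff, spanFinrank_maximalIdeal_quotient (span_sq_le_maximalIdeal_sq hs),
    ← ringKrullDim_quotient_span_singleton_succ_eq_ringKrullDim hreg hs]

/-- `A/(s) ≅ (A/(s²))/(s̄)` (third isomorphism theorem). -/
noncomputable def quotEquivQuotSqQuot (s : A) :
    (A ⧸ Ideal.span {s ^ 2}) ⧸ Ideal.span {Ideal.Quotient.mk (Ideal.span {s ^ 2}) s} ≃+*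
      A ⧸ Ideal.span {s} := by
  have h : (Ideal.span {s}).map (Ideal.Quotient.mk (Ideal.span {s ^ 2})) =
      Ideal.span {Ideal.Quotient.mk (Ideal.span {s ^ 2}) s} := by
    rw [Ideal.map_span, Set.image_singleton]
  refine (Ideal.quotEquivOfEq h.symm).trans (DoubleQuot.quotQuotEquivQuotOfLE ?_)
  exact Ideal.span_singleton_le_span_singleton.mpr (Dvd.intro s (by ring))

/-- ORDER-2 DETERMINACY, ring core: two Noetherian local rings with non-zero-divisors `s ∈ 𝔪_A`,
`s′ ∈ 𝔪_{A′}` and `A/(s²) ≅ A′/(s′²)` matching `s̄ ↦ s̄′` are regular together. [folklore] -/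
theorem isRegularLocalRing_iff_of_quotSq_equiv {A' : Type*} [CommRing A'] [IsLocalRing A']
    [IsNoetherianRing A'] {s : A} {s' : A'} (hs : s ∈ maximalIdeal A) (hreg : IsSMulRegular A s)
    (hs' : s' ∈ maximalIdeal A') (hreg' : IsSMulRegular A' s')
    [IsLocalRing (A ⧸ Ideal.span {s ^ 2})] [IsLocalRing (A' ⧸ Ideal.span {s' ^ 2})]
    (e : (A ⧸ Ideal.span {s ^ 2}) ≃+* (A' ⧸ Ideal.span {s' ^ 2}))
    (he : e (Ideal.Quotient.mk _ s) = Ideal.Quotient.mk _ s') :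
    IsRegularLocalRing A ↔ IsRegularLocalRing A' := by
  rw [isRegularLocalRing_iff_sq hs hreg, isRegularLocalRing_iff_sq hs' hreg']
  have h1 : (maximalIdeal (A ⧸ Ideal.span {s ^ 2})).spanFinrank =
      (maximalIdeal (A' ⧸ Ideal.span {s' ^ 2})).spanFinrank := by
    rw [← map_ringEquiv_maximalIdeal e, Ideal.spanFinrank_map_eq_of_ringEquiv]
  have hJ : Ideal.span {Ideal.Quotient.mk (Ideal.span {s' ^ 2}) s'} =
      (Ideal.span {Ideal.Quotient.mk (Ideal.span {s ^ 2}) s}).map (e : _ →+* _) := by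
    rw [Ideal.map_span, Set.image_singleton]
    simp [he]
  have h2 : ringKrullDim (A ⧸ Ideal.span {s}) = ringKrullDim (A' ⧸ Ideal.span {s'}) :=
    ringKrullDim_eq_of_ringEquiv
      ((quotEquivQuotSqQuot s).symm.trans
        ((Ideal.quotientEquiv _ _ e hJ).trans (quotEquivQuotSqQuot s')))
  rw [h1, h2]

end Determinacy

end Summit.ResolutionOfSingularities.ResolutionOfSingularities.Cruxes.DescentPerfectToAll.ArtinGreenberg
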